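import Literature.MathematicalPhysics.KineticTheory.HardSphereEulerLocalTheoryReduction
import Literature.Analysis.FluidPDE.CompressibleEulerCoefficientShape
import HarnessLib

/-!
# σ-uniform coefficient bounds for the hard-sphere equation-of-state family, I:
# the rescaled laws `ζ_τ(s) = Z(sτ)` and the thresholds

MathematicalPhysics/KineticTheory support file (theorems only; no definitions, no named facts).
For the hard-sphere Euler system at reduced diameter `σ` the pressure law is
`p = hsPressure σ ρ ϑ = ρ ϑ Z(ρσ³)` with the compressibility factor `Z = hsCompressibility`,
which under the standing equation-of-state hypothesis of `hsEuler_localExistence` agrees on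
`[0, η₀/2]` with a globally smooth function (`exists_contDiff_eqOn_hsCompressibility`). This is
the monatomic athermal law `p = ρϑζ(ρ)` of `Literature.Analysis.FluidPDE.CompressibleEuler` for
the RESCALED law `ζ = ζ_τ`, `ζ_τ(s) = Z(sτ)`, `τ = σ³`
(`isHardSphereEulerSolution_iff_isClassicalEulerSolution`). The `H^m` energy estimates of
`CompressibleEulerAprioriBounds` (Majda 1984, Ch. 2 §2.1, Thm 2.2) consume bounds on `ζ_τ`, on
the radial weight profile `Arad ζ_τ = (ζ_τ + sζ_τ')/s` of `CompressibleEulerCoefficientShape`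
and on their `s`-derivatives over the state range of the solution; for the hydrodynamic limit
(`σ → 0` at fixed macroscopic state) these bounds must be UNIFORM in `σ`. Since
`ζ_τ⁽ᵏ⁾(s) = τᵏ Z⁽ᵏ⁾(sτ)` and `Arad ζ_τ (s) = Γ₁(sτ)/s` with `Γ₁(η) = Z(η) + ηZ'(η) = (ηZ)'(η)`,
all these quantities are iterated slice derivatives of functions jointly `C^∞` in
`(τ, s) ∈ ℝ × (0, ∞)`, hence jointly continuous, hence bounded on every compact
`[0, τ₁] × [r₀, r₁]`, `r₀ > 0` — uniformly down to `τ = 0` (the ideal gas `ζ₀ ≡ Z(0) = 1`).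

* §1 `contDiffOn_uncurry_iterate_deriv`, `exists_bound_iterate_deriv`: the iterated slice
  derivatives `(d/dr)ʲ g(a, ·)` of a function jointly `C^∞` on an open `U ⊆ ℝ²` are jointly
  `C^∞` on `U` (iterate `DiffMonomial.contDiffOn_dT`) and bounded on compact `K ⊆ U`.
* §2 the rescaled family: the chain rule `deriv_rescale` (`ζ_τ' = τ Z'(·τ)`),
  `rescale_add_mul_deriv` (`ζ_τ + sζ_τ' = Γ₁(sτ)`), `deriv_mul_rescale` (`(sζ_τ)' = Γ₁(sτ)`, the
  hyperbolicity quantity of `CompressibleEulerLocalWellPosedness`), `arad_rescale_eq`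
  (`Arad ζ_τ = Γ₁(·τ)/·` as functions), and **`exists_uniform_family_bounds`**: one constant
  `B` with `|(Arad ζ_τ)⁽ʲ⁾(r)|, |ζ_τ⁽ʲ⁾(r)| ≤ B` for all `τ ∈ [0, τ₁]`, `r ∈ [r₀, r₁]`, `j ≤ N`.
* §3 the equation of state: **`exists_eos_family`** — a smooth `Z` with `hsCompressibility = Z`
  on `[0, η₀/2]` and a threshold `η_c ∈ (0, η₀/2]` with `Z(η), Γ₁(η) ∈ [1/2, 3/2]` for
  `|η| ≤ η_c` (continuity at `η = 0`, where `Z(0) = hsCompressibility 0 = 1`; `Γ₁ ≥ 1/2` is the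
  quantitative form of the hyperbolicity threshold `exists_hyperbolicityThreshold`, i.e.
  `∂p/∂ρ = ϑ Γ₁(ρσ³) ≥ ϑ/2`, Dafermos 2005, Thm 5.1.1), and `hsPressure_eq_of_eqOn`.

Deliberately NOT here (sequel `HardSphereEulerUniformCoefficientsB.lean`): the fibred state set
`[3/(4M), 5M/4]² ∩ {ρτ ≤ η_c}` of a solution in a box around a constant state, the explicit
two-sided weight bounds and the eleven state bounds of
`CompressibleEuler.abs_integral_timeDerivWithin_weighted_le` on it, and the packaged statement
with all constants quantified before `τ = σ³`.

## Mathlib / tree search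

Tree: `DiffMonomial.dT`, `DiffMonomial.contDiffOn_dT` (`TorusDiffMonomials`),
`CompressibleEuler.Arad` (`CompressibleEulerCoefficientShape`),
`exists_contDiff_eqOn_hsCompressibility`, `exists_hyperbolicityThreshold`,
`deriv_mul_comp_rescale_pos` (`HardSphereEulerLocalTheoryReduction`), `exists_bound_derivs₃`
(`CompressibleEulerCoefficientBounds`, one-variable pattern). Mathlib:
`IsCompact.exists_bound_of_continuousOn`, `ContDiffOn.div`, `contDiff_infty_iff_deriv`,
`HasDerivAt.comp`, `Metric.continuous_iff`, `Function.iterate_succ_apply'`.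

## References

* A. Majda, *Compressible Fluid Flow and Systems of Conservation Laws in Several Space
  Variables*, Appl. Math. Sci. 53, Springer 1984: Ch. 2 §2.1, (2.8)–(2.10) and Thm 2.2 (the
  constants of the energy inequality depend on the law only through bounds for the
  coefficients and their derivatives on the state range). [`Majda1984`]
* C. M. Dafermos, *Hyperbolic Conservation Laws in Continuum Physics*, 2nd ed., Grundlehren
  325, Springer 2005: Ch. V §5.1, Thm 5.1.1 (convex entropy / hyperbolicity threshold).
  [`Dafermos2005`]
-/

noncomputable section

open Set Function Filter
open _root_.Topology
open scoped ContDiff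

namespace Literature.MathematicalPhysics.KineticTheory

open Literature.Analysis.FunctionSpaces.Torus.DiffMonomial (dR dT contDiffOn_dT)
open Literature.Analysis.FluidPDE.CompressibleEuler (Arad)

namespace HsEulerUniform

/-! ## §1 Iterated slice derivatives of a jointly smooth two-variable function -/

/-- If `(a, r) ↦ g a r` is `C^∞` on an open set `U ⊆ ℝ²`, then so is
`(a, r) ↦ (d/dr)^j g(a, ·)(r)` for every `j` (iterate `DiffMonomial.contDiffOn_dT`: the slice
derivative of a jointly smooth function is jointly smooth). [folklore] -/
theorem contDiffOn_uncurry_iterate_deriv {g : ℝ → ℝ → ℝ} {U : Set (ℝ × ℝ)}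
    (hg : ContDiffOn ℝ ∞ (uncurry g) U) (hU : IsOpen U) :
    ∀ j : ℕ, ContDiffOn ℝ ∞ (uncurry fun a r => deriv^[j] (g a) r) U
  | 0 => hg
  | j + 1 => by
    have h := contDiffOn_dT (contDiffOn_uncurry_iterate_deriv hg hU j) hU
    have he : (uncurry fun a r => deriv^[j + 1] (g a) r) =
        uncurry (dT fun a r => deriv^[j] (g a) r) := by
      funext p
      simp only [Function.uncurry, dT, Function.iterate_succ_apply']
    rw [he]
    exact h

/-- **Uniform bounds for iterated slice derivatives on a compact set.** If `uncurry g` is `C^∞`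
on an open `U` and `K ⊆ U` is compact, then the `r`-derivatives `(d/dr)^j g(a, ·)(r)`,
`j ≤ N`, are bounded on `K` by one constant `B ≥ 0` (continuity on a compact set).
[folklore] -/
theorem exists_bound_iterate_deriv {g : ℝ → ℝ → ℝ} {U : Set (ℝ × ℝ)}
    (hg : ContDiffOn ℝ ∞ (uncurry g) U) (hU : IsOpen U) {K : Set (ℝ × ℝ)} (hK : IsCompact K)
    (hKU : K ⊆ U) : ∀ N : ℕ, ∃ B : ℝ, 0 ≤ B ∧ ∀ z ∈ K, ∀ j ≤ N, |deriv^[j] (g z.1) z.2| ≤ B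
  | 0 => by
    obtain ⟨B, hB⟩ := hK.exists_bound_of_continuousOn
      ((contDiffOn_uncurry_iterate_deriv hg hU 0).continuousOn.mono hKU)
    refine ⟨max B 0, le_max_right _ _, fun z hz j hj => ?_⟩
    obtain rfl : j = 0 := Nat.le_zero.1 hj
    have h := hB z hz
    rw [Real.norm_eq_abs] at h
    exact h.trans (le_max_left _ _)
  | N + 1 => by
    obtain ⟨B, hB0, hB⟩ := exists_bound_iterate_deriv hg hU hK hKU N
    obtain ⟨B', hB'⟩ := hK.exists_bound_of_continuousOn
      ((contDiffOn_uncurry_iterate_deriv hg hU (N + 1)).continuousOn.mono hKU)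
    refine ⟨max B B', hB0.trans (le_max_left _ _), fun z hz j hj => ?_⟩
    rcases Nat.of_le_succ hj with h | h
    · exact (hB z hz j h).trans (le_max_left _ _)
    · subst h
      have h := hB' z hz
      rw [Real.norm_eq_abs] at h
      exact h.trans (le_max_right _ _)

/-! ## §2 The rescaled family `ζ_τ(s) = Z(sτ)`, `τ = σ³` -/

variable {Z : ℝ → ℝ}

/-- Chain rule for the rescaled law: `(d/ds) Z(sτ) = τ Z'(sτ)`. [folklore] -/
theorem deriv_rescale (hZ : ContDiff ℝ ∞ Z) (τ r : ℝ) :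
    deriv (fun s => Z (s * τ)) r = τ * deriv Z (r * τ) := by
  have h1 : HasDerivAt (fun s : ℝ => s * τ) τ r := by
    simpa using (hasDerivAt_id r).mul_const τ
  have h2 : HasDerivAt (fun s => Z (s * τ)) (deriv Z (r * τ) * τ) r :=
    ((hZ.differentiable (by simp)) (r * τ)).hasDerivAt.comp r h1
  rw [h2.deriv, mul_comm]

/-- `ζ_τ(r) + r ζ_τ'(r) = Γ₁(rτ)` with `Γ₁(η) = Z(η) + η Z'(η)`: the numerator of the weight
`A = ϑ (ζ + ρζ')/ρ` for the rescaled law depends on `(r, τ)` only through `η = rτ`. [folklore] -/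
theorem rescale_add_mul_deriv (hZ : ContDiff ℝ ∞ Z) (τ r : ℝ) :
    Z (r * τ) + r * deriv (fun s => Z (s * τ)) r = Z (r * τ) + r * τ * deriv Z (r * τ) := by
  rw [deriv_rescale hZ]
  ring

/-- `(r ζ_τ(r))' = Z(rτ) + rτ Z'(rτ)`. [folklore] -/
theorem deriv_mul_rescale (hZ : ContDiff ℝ ∞ Z) (τ r : ℝ) :
    deriv (fun s => s * Z (s * τ)) r = Z (r * τ) + r * τ * deriv Z (r * τ) := by
  have h1 : HasDerivAt (fun s : ℝ => s * τ) τ r := by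
    simpa using (hasDerivAt_id r).mul_const τ
  have h2 : HasDerivAt (fun s => Z (s * τ)) (deriv Z (r * τ) * τ) r :=
    ((hZ.differentiable (by simp)) (r * τ)).hasDerivAt.comp r h1
  have h3 : HasDerivAt (fun s => s * Z (s * τ)) (1 * Z (r * τ) + r * (deriv Z (r * τ) * τ)) r :=
    (hasDerivAt_id' r).fun_mul h2
  rw [h3.deriv]
  ring

/-- The radial part `(ζ_τ(s) + s ζ_τ'(s))/s` of the weight `A` for the rescaled law, as a
function of `s`, in closed form `(Z(sτ) + sτ Z'(sτ))/s` (equality of functions; at `s = 0` both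
sides are the junk value `x/0 = 0`). [folklore] -/
theorem arad_rescale_eq (hZ : ContDiff ℝ ∞ Z) (τ : ℝ) :
    Arad (fun s => Z (s * τ)) = fun s => (Z (s * τ) + s * τ * deriv Z (s * τ)) / s := by
  funext s
  show (Z (s * τ) + s * deriv (fun s' => Z (s' * τ)) s) / s = _
  rw [rescale_add_mul_deriv hZ]

/-- `(τ, r) ↦ Z(rτ)` is jointly `C^∞`. [folklore] -/
theorem contDiff_uncurry_rescale (hZ : ContDiff ℝ ∞ Z) :
    ContDiff ℝ ∞ (uncurry fun a r : ℝ => Z (r * a)) :=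
  hZ.comp (contDiff_snd.mul contDiff_fst)

/-- `(τ, r) ↦ (Z(rτ) + rτ Z'(rτ))/r` is jointly `C^∞` on `{r > 0}`. [folklore] -/
theorem contDiffOn_uncurry_arad_rescale (hZ : ContDiff ℝ ∞ Z) :
    ContDiffOn ℝ ∞ (uncurry fun a r : ℝ => (Z (r * a) + r * a * deriv Z (r * a)) / r)
      ((univ : Set ℝ) ×ˢ Ioi (0 : ℝ)) := by
  have hZ' : ContDiff ℝ ∞ (deriv Z) := (contDiff_infty_iff_deriv.1 hZ).2
  have hlin : ContDiff ℝ ∞ fun p : ℝ × ℝ => p.2 * p.1 := contDiff_snd.mul contDiff_fst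
  have hnum : ContDiff ℝ ∞ fun p : ℝ × ℝ => Z (p.2 * p.1) + p.2 * p.1 * deriv Z (p.2 * p.1) :=
    (hZ.comp hlin).add (hlin.mul (hZ'.comp hlin))
  have h : (uncurry fun a r : ℝ => (Z (r * a) + r * a * deriv Z (r * a)) / r) =
      fun p : ℝ × ℝ => (Z (p.2 * p.1) + p.2 * p.1 * deriv Z (p.2 * p.1)) / p.2 := by
    funext ⟨a, r⟩; rfl
  rw [h]
  exact hnum.contDiffOn.div contDiffOn_snd fun p hp => (mem_prod.1 hp).2.ne'

/-- **Uniform family bounds (compactness in `(τ, r)`).** For a smooth `Z`, the derivatives of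
orders `j ≤ N` of the rescaled law `ζ_τ(s) = Z(sτ)` and of the radial weight
`(ζ_τ(s) + s ζ_τ'(s))/s` are bounded by ONE constant `B` for all `τ ∈ [0, τ₁]` and
`r ∈ [r₀, r₁]`, `r₀ > 0`: both are iterated slice derivatives of functions jointly `C^∞` on
`ℝ × (0, ∞)`, hence jointly continuous, and `[0, τ₁] × [r₀, r₁]` is compact. This is the only
place where the scaling `ζ_σ^{(k)}(r) = σ^{3k} Z^{(k)}(rσ³)` enters: as continuity in `τ = σ³`
down to `τ = 0`. [folklore] -/
theorem exists_uniform_family_bounds (hZ : ContDiff ℝ ∞ Z) (τ₁ r₁ : ℝ) {r₀ : ℝ} (hr₀ : 0 < r₀)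
    (N : ℕ) : ∃ B : ℝ, 0 ≤ B ∧ ∀ τ ∈ Icc 0 τ₁, ∀ r ∈ Icc r₀ r₁, ∀ j ≤ N,
      |deriv^[j] (Arad fun s => Z (s * τ)) r| ≤ B ∧ |deriv^[j] (fun s => Z (s * τ)) r| ≤ B := by
  have hK : IsCompact (Icc 0 τ₁ ×ˢ Icc r₀ r₁) := isCompact_Icc.prod isCompact_Icc
  have hU : IsOpen ((univ : Set ℝ) ×ˢ Ioi (0 : ℝ)) := isOpen_univ.prod isOpen_Ioi
  have hKU : Icc 0 τ₁ ×ˢ Icc r₀ r₁ ⊆ (univ : Set ℝ) ×ˢ Ioi (0 : ℝ) :=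
    fun z hz => ⟨mem_univ _, hr₀.trans_le (mem_prod.1 hz).2.1⟩
  obtain ⟨B₁, hB₁0, hB₁⟩ := exists_bound_iterate_deriv
    (contDiff_uncurry_rescale hZ).contDiffOn hU hK hKU N
  obtain ⟨B₂, -, hB₂⟩ := exists_bound_iterate_deriv (contDiffOn_uncurry_arad_rescale hZ)
    hU hK hKU N
  refine ⟨max B₁ B₂, hB₁0.trans (le_max_left _ _), fun τ hτ r hr j hj => ⟨?_, ?_⟩⟩
  · rw [arad_rescale_eq hZ τ]
    exact (hB₂ (τ, r) (mk_mem_prod hτ hr) j hj).trans (le_max_right _ _)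
  · exact (hB₁ (τ, r) (mk_mem_prod hτ hr) j hj).trans (le_max_left _ _)

/-! ## §3 The equation of state: smooth `Z` and the thresholds -/

/-- A function continuous on `ℝ` with value `1` at `0` stays in `[1/2, 3/2]` on some `[-δ, δ]`,
`δ > 0`. [folklore] -/
theorem exists_near_one {g : ℝ → ℝ} (hg : Continuous g) (h0 : g 0 = 1) :
    ∃ δ : ℝ, 0 < δ ∧ ∀ η : ℝ, |η| ≤ δ → 1 / 2 ≤ g η ∧ g η ≤ 3 / 2 := by
  obtain ⟨δ, hδ, hball⟩ := Metric.continuous_iff.1 hg 0 (1 / 2) one_half_pos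
  refine ⟨δ / 2, half_pos hδ, fun η hη => ?_⟩
  have hd : dist η 0 < δ := by
    rw [Real.dist_eq, sub_zero]
    linarith
  have h := hball η hd
  rw [h0, Real.dist_eq] at h
  obtain ⟨h1, h2⟩ := abs_lt.1 h
  constructor <;> linarith

/-- **The smooth equation of state with its thresholds.** Under the standing hypothesis of
`hsEuler_localExistence` (the excess free energy agrees on `[0, η₀)` with `F` analytic on
`(-η₀, η₀)`) there are a globally smooth `Z` with `hsCompressibility = Z` on `[0, η₀/2]`
(`exists_contDiff_eqOn_hsCompressibility`) and a threshold `η_c ∈ (0, η₀/2]` such that both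
`Z(η)` and `Γ₁(η) = Z(η) + ηZ'(η) = (ηZ)'` lie in `[1/2, 3/2]` for `|η| ≤ η_c` (continuity at
`η = 0`, where `Z(0) = hsCompressibility 0 = 1`). `Γ₁ ≥ 1/2` is quantitative hyperbolicity
(`∂p/∂ρ = ϑ Γ₁(ρσ³) ≥ ϑ/2`), cf. `exists_hyperbolicityThreshold`, `exists_packing_threshold`.
[cite: Dafermos2005, Thm 5.1.1] -/
theorem exists_eos_family {η₀ : ℝ} (hη₀ : 0 < η₀) {F : ℝ → ℝ}
    (hF : AnalyticOnNhd ℝ F (Ioo (-η₀) η₀)) (hEq : EqOn hsExcessFreeEnergy F (Ico 0 η₀)) :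
    ∃ Z : ℝ → ℝ, ∃ ηc : ℝ, ContDiff ℝ ∞ Z ∧ EqOn hsCompressibility Z (Icc 0 (η₀ / 2)) ∧
      0 < ηc ∧ ηc ≤ η₀ / 2 ∧ ∀ η : ℝ, |η| ≤ ηc →
        (1 / 2 ≤ Z η ∧ Z η ≤ 3 / 2) ∧
          (1 / 2 ≤ Z η + η * deriv Z η ∧ Z η + η * deriv Z η ≤ 3 / 2) := by
  obtain ⟨Z, hZ, hZeq⟩ := exists_contDiff_eqOn_hsCompressibility hη₀ hF hEq
  have hZ0 : Z 0 = 1 := by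
    rw [← hZeq ⟨le_rfl, (half_pos hη₀).le⟩]
    simp [hsCompressibility]
  have hc2 : Continuous fun η => Z η + η * deriv Z η :=
    hZ.continuous.add (continuous_id.mul (hZ.continuous_deriv (by simp)))
  obtain ⟨δ₁, hδ₁, h₁⟩ := exists_near_one hZ.continuous hZ0
  obtain ⟨δ₂, hδ₂, h₂⟩ := exists_near_one hc2 (by simp [hZ0])
  refine ⟨Z, min (η₀ / 2) (min δ₁ δ₂), hZ, hZeq, lt_min (half_pos hη₀) (lt_min hδ₁ hδ₂),
    min_le_left _ _, fun η hη => ⟨h₁ η ?_, h₂ η ?_⟩⟩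
  · exact hη.trans ((min_le_right _ _).trans (min_le_left _ _))
  · exact hη.trans ((min_le_right _ _).trans (min_le_right _ _))

/-- The hard-sphere pressure law below the threshold is the smooth law `p = ρ ϑ Z(ρσ³)`
(unfold `hsPressure` and use `hsCompressibility = Z` at the packing `ρσ³ ∈ [0, η₁]`).
[folklore] -/
theorem hsPressure_eq_of_eqOn {η₁ : ℝ} (hZeq : EqOn hsCompressibility Z (Icc 0 η₁)) {σ ρ : ℝ}
    (θ : ℝ) (h : ρ * σ ^ 3 ∈ Icc 0 η₁) : hsPressure σ ρ θ = ρ * θ * Z (ρ * σ ^ 3) := by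
  show ρ * θ * hsCompressibility (ρ * σ ^ 3) = _
  rw [hZeq h]

end HsEulerUniform

end Literature.MathematicalPhysics.KineticTheory

end
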